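import Literature.MathematicalPhysics.QuantumFieldTheory.Balaban1983to89.B12Pairing543

/-!
# Bałaban CMP 109 (1987) §5, (5.43) with BACKWARD curls: the printed leading kernel, by lattice reflection

CITATION HEADER (lean-in-tree rule 2026-08-18).  Source: T. Bałaban, *Renormalization group approach to lattice
gauge field theories. I.*, Commun. Math. Phys. **109**, 249–301 (1987), doi:10.1007/bf01215223 [Balaban1987RG1]
(held: `paper:balaban1987-cmp109-rg-i-small-field`; journal page = PDF page + 248); displays (4.42) p. 291 [PDF 43],
(5.11)/(5.16) p. 293 [45], (5.37)/(5.43) p. 297 [49] as quoted verbatim in the header of `…B12Pairing543` (same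
unit), re-read there on the 300-dpi renders.  Audit cell `pub-balaban`, unit `b2b-balaban-b03-g6` (B12 §§2–5
lineage), node B12-PAIRING-BACKWARD; sits on top of `…B12Pairing543` (`curl`, `fsq`, `pairing`, `transposeK`,
`bvec`, `fsq_eq_pairing_transpose`, the two-bond values) and `…B12WardLeadingForm` (`wilsonQ_neg`, `dirac_neg`,
`delta_comm`).  Value = kernel certificate of a DICTIONARY (which difference convention produces which kernel),
completing the located imprecision GAPS G-b03g6-4 / C-b03g6-6 and the cross-read remark C-pv03-28 (iii) («the printed
kernel gives the backward form», there by hand and by exact integers for d = 2, 3) for every d; NOT summit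
progress; nothing about the sign or size of β.

WHAT IS TYPED AND PROVED (scalar components, fields `a b : Fin d → Pt d → ℂ` vanishing off finite sets).
* `curlB a μ ν x = (Δ_μ a_ν)(x) − (Δ_ν a_μ)(x)` with the BACKWARD-looking difference `PeriodicGleason.delta`
  (`(Δ_μ g)(x) = g(x − e_μ) − g(x)`: the position-space operator whose symbol under (5.11) is the printed conjugate
  factor \overline{∂_μ(p)} = e^{−ip_μ} − 1, exactly as `B12Rep537.fdelta` carries ∂_μ(p) = e^{ip_μ} − 1;
  `PeriodicGleason.genFun_delta`, `B12Rep537.genFun_fdelta`), `fsqB a b = ½ Σ'_x Σ_{μν} (curlB a)_{μν}(x)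
  (curlB b)_{μν}(x)`; `refl a μ x = a μ (−x)` (lattice reflection of a field), `reflK K μ ν z = K μ ν (−z)`.
* DICTIONARY (`curlB_refl`, `fsqB_eq_fsq_refl`, `fsq_eq_fsqB_refl`): the reflection x ↦ −x exchanges the two
  curls, `curlB a μ ν (−x) = curl (refl a) μ ν x`, hence `fsqB a b = fsq (refl a) (refl b)`; and it acts on
  pairing kernels by `z ↦ −z` (`pairing_refl`), which for the leading form is TRANSPOSITION:
  `reflK wilsonQ = transposeK wilsonQ` (`B12WardLeadingForm.wilsonQ_neg`).
* MAIN (`fsqB_eq_pairing_printed`, `fsqB_bvec`): `fsqB a b = pairing wilsonQ A B a b` — with backward curls the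
  marginal term of (5.43)/(4.42) pairs `a = δB`, `b = B` through EXACTLY the printed leading kernel `wilsonQ μ ν` of
  (5.16)/(5.36)/(5.37) (symbol δ_{μν}Δ(p) − \overline{∂_μ(p)}∂_ν(p) under (5.11)), whereas with the forward curls
  fixed by the series' convention (Bałaban CMP 95 (1984) p. 18 (1.2), cell NOTATION.md §2.2) it pairs them through
  the transpose (`B12Pairing543.fsq_eq_pairing_transpose`; restated here as `fsq_eq_pairing_reflected`:
  through `reflK wilsonQ`).  So the imprecision located in G-b03g6-4 is PRECISELY a forward/backward (equivalently:
  z ↦ −z, equivalently: μν-transposition) convention slip between the curl of (4.42)/(5.43) and the bars of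
  (5.16); both kernels are legitimate, one per convention, and everything B12 does with (5.37) is insensitive to
  the choice (same Taylor data to second order, `B12WardLeadingForm.taylorData3_wilsonQ_transpose`).
* The two-bond values under the backward convention (`fsqB_bvec_adjacent`, `fsqB_bvec_nonadjacent`, μ₀ ≠ ν₀): the
  bonds (x₀, μ₀), (x₀ − e_{ν₀}, ν₀) give `fsqB = 0` (they bound no common BACKWARD plaquette) and (x₀, μ₀),
  (x₀ − e_{μ₀}, ν₀) give `fsqB = 1` — the printed kernel's values (`B12Pairing543.pairing_printed_adjacent /
  _nonadjacent`), opposite to the forward ones (`fsq_ne_fsqB`).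
* Sanity (`curlB_gradB`, `fsqB_gradB_left/right`): `fsqB` is gauge invariant too (backward differences commute).
Nothing here is a cited fact; every statement is proved from the definitions.
-/

namespace Literature.MathematicalPhysics.QuantumFieldTheory.Balaban1983to89.B12Pairing543Backward

noncomputable section

open Literature.MathematicalPhysics.QuantumFieldTheory.GawedzkiKupiainen1985.PeriodicGleason
open Literature.MathematicalPhysics.QuantumFieldTheory.Balaban1983to89.B12Rep537
open Literature.MathematicalPhysics.QuantumFieldTheory.Balaban1983to89.B12WardLeadingForm
open Literature.MathematicalPhysics.QuantumFieldTheory.Balaban1983to89.B12Pairing543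

variable {d : ℕ}

/-! ## Definitions -/

/-- The curl with the backward-looking difference `Δ_μ g(x) = g(x − e_μ) − g(x)` (symbol \overline{∂_μ(p)}):
`(curlB a)_{μν}(x) = (Δ_μa_ν)(x) − (Δ_νa_μ)(x)`. [cite: Balaban1987RG1, (4.42) p.291 / (5.43) p.297 (the curl ∂),
(5.15) p.293 (∂_μ, \overline{∂_μ})] -/
def curlB (a : Fin d → Pt d → ℂ) (μ ν : Fin d) (x : Pt d) : ℂ := delta μ (a ν) x - delta ν (a μ) x

/-- The backward gradient of a scalar `λ`. [folklore] -/
def gradB (lam : Pt d → ℂ) : Fin d → Pt d → ℂ := fun μ => delta μ lam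

/-- **The marginal term with backward curls**: `½ Σ_x Σ_{μν} (curlB a)_{μν}(x)(curlB b)_{μν}(x)`.
[cite: Balaban1987RG1, (5.43) p.297; (4.42) p.291] -/
def fsqB (a b : Fin d → Pt d → ℂ) : ℂ := (1 / 2) * ∑' x, ∑ μ, ∑ ν, curlB a μ ν x * curlB b μ ν x

/-- Lattice reflection of a field: `(refl a)_μ(x) = a_μ(−x)`. [folklore] -/
def refl (a : Fin d → Pt d → ℂ) : Fin d → Pt d → ℂ := fun μ x => a μ (-x)

/-- Lattice reflection of a pairing kernel: `(reflK K)_{μν}(z) = K_{μν}(−z)`. [folklore] -/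
def reflK (K : Fin d → Fin d → Pt d → ℂ) : Fin d → Fin d → Pt d → ℂ := fun μ ν z => K μ ν (-z)

/-! ## Gauge invariance of `fsqB` -/

/-- `curlB ∘ gradB = 0` (backward differences commute, `B12WardLeadingForm.delta_comm`). [folklore] -/
theorem curlB_gradB (lam : Pt d → ℂ) : curlB (gradB lam) = 0 := by
  funext μ ν x
  show delta μ (delta ν lam) x - delta ν (delta μ lam) x = 0
  rw [delta_comm, sub_self]

/-- `fsqB (Δλ, b) = 0`. [folklore] -/
theorem fsqB_gradB_left (lam : Pt d → ℂ) (b : Fin d → Pt d → ℂ) : fsqB (gradB lam) b = 0 := by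
  simp [fsqB, curlB_gradB]

/-- `fsqB (a, Δλ) = 0`. [folklore] -/
theorem fsqB_gradB_right (a : Fin d → Pt d → ℂ) (lam : Pt d → ℂ) : fsqB a (gradB lam) = 0 := by
  simp [fsqB, curlB_gradB]

/-! ## The reflection dictionary -/

/-- Reflection is an involution on fields. [folklore] -/
theorem refl_refl (a : Fin d → Pt d → ℂ) : refl (refl a) = a := by
  funext μ x; simp [refl]

/-- Reflection is an involution on kernels. [folklore] -/
theorem reflK_reflK (K : Fin d → Fin d → Pt d → ℂ) : reflK (reflK K) = K := by
  funext μ ν z; simp [reflK]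

/-- Reflection turns the backward-looking difference into the forward one:
`(Δ_μ g)(−x) = (∂_μ (g ∘ refl))(x)`. [folklore] -/
theorem delta_neg_eq_fdelta (μ : Fin d) (g : Pt d → ℂ) (x : Pt d) :
    delta μ g (-x) = fdelta μ (fun z => g (-z)) x := by
  show g (-x - unitVec μ) - g (-x) = g (-(x + unitVec μ)) - g (-x)
  rw [neg_add']

/-- **The two curls are exchanged by reflection**: `(curlB a)_{μν}(−x) = (curl (refl a))_{μν}(x)`. [folklore] -/
theorem curlB_refl (a : Fin d → Pt d → ℂ) (μ ν : Fin d) (x : Pt d) :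
    curlB a μ ν (-x) = curl (refl a) μ ν x := by
  simp only [curlB, curl, delta_neg_eq_fdelta]
  rfl

/-- The same, read at `−x`: `(curlB a)_{μν}(x) = (curl (refl a))_{μν}(−x)`. [folklore] -/
theorem curlB_eq_curl_refl_neg (a : Fin d → Pt d → ℂ) (μ ν : Fin d) (x : Pt d) :
    curlB a μ ν x = curl (refl a) μ ν (-x) := by
  rw [← curlB_refl, neg_neg]

/-- **`fsqB` is `fsq` of the reflected fields**: `fsqB a b = fsq (refl a) (refl b)` (reindex the lattice sum by
x ↦ −x). [folklore] -/
theorem fsqB_eq_fsq_refl (a b : Fin d → Pt d → ℂ) : fsqB a b = fsq (refl a) (refl b) := by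
  unfold fsqB fsq
  congr 1
  have h : ∀ x : Pt d, ∑ μ, ∑ ν, curlB a μ ν x * curlB b μ ν x =
      (fun y => ∑ μ, ∑ ν, curl (refl a) μ ν y * curl (refl b) μ ν y) ((Equiv.neg (Pt d)) x) := by
    intro x
    simp only [Equiv.neg_apply, curlB_eq_curl_refl_neg]
  rw [tsum_congr h]
  exact (Equiv.neg (Pt d)).tsum_eq (fun y => ∑ μ, ∑ ν, curl (refl a) μ ν y * curl (refl b) μ ν y)

/-- The converse reading: `fsq a b = fsqB (refl a) (refl b)`. [folklore] -/
theorem fsq_eq_fsqB_refl (a b : Fin d → Pt d → ℂ) : fsq a b = fsqB (refl a) (refl b) := by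
  rw [fsqB_eq_fsq_refl, refl_refl, refl_refl]

/-- A field vanishing off `A` reflects to a field vanishing off `−A`. [folklore] -/
theorem refl_support {A : Finset (Pt d)} {a : Fin d → Pt d → ℂ} (ha : ∀ μ x, x ∉ A → a μ x = 0) :
    ∀ μ x, x ∉ A.image Neg.neg → refl a μ x = 0 := by
  intro μ x hx
  apply ha
  intro hmem
  exact hx (Finset.mem_image.mpr ⟨-x, hmem, neg_neg x⟩)

/-- **Reflection acts on pairing kernels by `z ↦ −z`**: pairing the reflected fields over the reflected supports
through `K` is pairing the original fields through `reflK K`. [folklore] -/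
theorem pairing_refl (K : Fin d → Fin d → Pt d → ℂ) (A B : Finset (Pt d)) (a b : Fin d → Pt d → ℂ) :
    pairing K (A.image Neg.neg) (B.image Neg.neg) (refl a) (refl b) = pairing (reflK K) A B a b := by
  unfold pairing refl reflK
  rw [Finset.sum_image neg_injective.injOn]
  refine Finset.sum_congr rfl fun x _ => ?_
  rw [Finset.sum_image neg_injective.injOn]
  refine Finset.sum_congr rfl fun y _ => ?_
  simp only [neg_neg, neg_sub_neg, neg_sub]

/-- **For the leading form, reflection is transposition**: `wilsonQ μ ν (−z) = wilsonQ ν μ z`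
(`B12WardLeadingForm.wilsonQ_neg`), i.e. `reflK wilsonQ = transposeK wilsonQ`. [cite: Balaban1987RG1, (5.16) p.293;
(5.36)–(5.37) p.297] -/
theorem reflK_wilsonQ : reflK (wilsonQ : Fin d → Fin d → Pt d → ℂ) = transposeK wilsonQ := by
  funext μ ν z
  simp only [reflK, transposeK, wilsonQ_neg]

/-- Equivalently `reflK (transposeK wilsonQ) = wilsonQ`. [cite: Balaban1987RG1, (5.16) p.293; (5.36)–(5.37) p.297] -/
theorem reflK_transposeK_wilsonQ : reflK (transposeK (wilsonQ : Fin d → Fin d → Pt d → ℂ)) = wilsonQ := by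
  funext μ ν z
  simp only [reflK, transposeK, wilsonQ_neg]

/-! ## Main statement: backward curls pair through the printed kernel -/

/-- **(5.43), first term, with BACKWARD curls**: for fields `a`, `b` vanishing off finite sets `A`, `B`,
`½ Σ_x Σ_{μν} (curlB a)_{μν}(x)(curlB b)_{μν}(x) = Σ_{x∈A} Σ_{y∈B} Σ_{μν} wilsonQ μ ν (x − y) a_μ(x) b_ν(y)` — EXACTLY
the printed leading kernel of (5.16)/(5.36)/(5.37) (symbol δ_{μν}Δ(p) − \overline{∂_μ(p)}∂_ν(p) under (5.11)).
[cite: Balaban1987RG1, (5.43) p.297; (5.16) p.293; (5.36)–(5.37) p.297] -/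
theorem fsqB_eq_pairing_printed {A B : Finset (Pt d)} {a b : Fin d → Pt d → ℂ}
    (ha : ∀ μ x, x ∉ A → a μ x = 0) (hb : ∀ ν y, y ∉ B → b ν y = 0) :
    fsqB a b = pairing wilsonQ A B a b := by
  rw [fsqB_eq_fsq_refl, fsq_eq_pairing_transpose (refl_support ha) (refl_support hb), pairing_refl,
    reflK_transposeK_wilsonQ]

/-- The forward statement of `B12Pairing543` in the same language: with FORWARD curls (the series' convention) the
kernel is the REFLECTED printed kernel `wilsonQ μ ν (y − x)` (= the transposed one). [cite: Balaban1987RG1, (5.43)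
p.297; (5.16) p.293] -/
theorem fsq_eq_pairing_reflected {A B : Finset (Pt d)} {a b : Fin d → Pt d → ℂ}
    (ha : ∀ μ x, x ∉ A → a μ x = 0) (hb : ∀ ν y, y ∉ B → b ν y = 0) :
    fsq a b = pairing (reflK wilsonQ) A B a b := by
  rw [fsq_eq_pairing_transpose ha hb, reflK_wilsonQ]

/-! ## Bond fields under the backward convention -/

/-- A bond field vanishes off its site. [folklore] -/
theorem bvec_support (μ₀ : Fin d) (x₀ : Pt d) :
    ∀ μ x, x ∉ ({x₀} : Finset (Pt d)) → bvec μ₀ x₀ μ x = 0 := by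
  intro μ x hx
  have hne : x - x₀ ≠ 0 := sub_ne_zero.mpr (fun h => hx (Finset.mem_singleton.mpr h))
  simp [bvec, dirac, hne]

/-- Reflection of a bond field: `refl (bvec μ₀ x₀) = bvec μ₀ (−x₀)`. [folklore] -/
theorem refl_bvec (μ₀ : Fin d) (x₀ : Pt d) : refl (bvec μ₀ x₀) = bvec μ₀ (-x₀) := by
  funext κ x
  simp only [refl, bvec]
  rw [show -x - x₀ = -(x - -x₀) by abel, dirac_neg]

/-- **Matrix elements**: `fsqB (bvec μ₀ x₀) (bvec ν₀ y₀) = wilsonQ μ₀ ν₀ (x₀ − y₀)` — the printed kernel (compare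
`B12Pairing543.fsq_bvec`: `wilsonQ ν₀ μ₀ (x₀ − y₀)` for forward curls). [cite: Balaban1987RG1, (5.43) p.297; (5.16)
p.293] -/
theorem fsqB_bvec (μ₀ ν₀ : Fin d) (x₀ y₀ : Pt d) :
    fsqB (bvec μ₀ x₀) (bvec ν₀ y₀) = wilsonQ μ₀ ν₀ (x₀ - y₀) := by
  rw [fsqB_eq_pairing_printed (bvec_support μ₀ x₀) (bvec_support ν₀ y₀), pairing_bvec]

/-- ADJACENT (forward) bonds `(x₀, μ₀)`, `(x₀ − e_{ν₀}, ν₀)` (μ₀ ≠ ν₀): `fsqB = 0` — the printed kernel's value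
(`B12Pairing543.pairing_printed_adjacent`), versus `fsq = 1` (`B12Pairing543.fsq_bvec_adjacent`).
[cite: Balaban1987RG1, (5.43) p.297] -/
theorem fsqB_bvec_adjacent {μ₀ ν₀ : Fin d} (h : μ₀ ≠ ν₀) (x₀ : Pt d) :
    fsqB (bvec μ₀ x₀) (bvec ν₀ (x₀ - unitVec ν₀)) = 0 := by
  rw [fsqB_bvec, sub_sub_cancel, wilsonQ_printed_unitVec h]

/-- NON-ADJACENT (forward) bonds `(x₀, μ₀)`, `(x₀ − e_{μ₀}, ν₀)` (μ₀ ≠ ν₀): `fsqB = 1` — the printed kernel's value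
(`B12Pairing543.pairing_printed_nonadjacent`), versus `fsq = 0` (`B12Pairing543.fsq_bvec_nonadjacent`); under
the backward convention these two bonds DO bound a common plaquette. [cite: Balaban1987RG1, (5.43) p.297] -/
theorem fsqB_bvec_nonadjacent {μ₀ ν₀ : Fin d} (h : μ₀ ≠ ν₀) (x₀ : Pt d) :
    fsqB (bvec μ₀ x₀) (bvec ν₀ (x₀ - unitVec μ₀)) = 1 := by
  have h' : ν₀ ≠ μ₀ := fun e => h e.symm
  rw [fsqB_bvec, sub_sub_cancel, wilsonQ_transpose_unitVec h']

/-- The two conventions give different quadratic forms (witness: two adjacent forward bonds, `1 ≠ 0`).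
[cite: Balaban1987RG1, (5.43) p.297] -/
theorem fsq_ne_fsqB {μ₀ ν₀ : Fin d} (h : μ₀ ≠ ν₀) (x₀ : Pt d) :
    fsq (bvec μ₀ x₀) (bvec ν₀ (x₀ - unitVec ν₀)) ≠ fsqB (bvec μ₀ x₀) (bvec ν₀ (x₀ - unitVec ν₀)) := by
  rw [fsq_bvec_adjacent h, fsqB_bvec_adjacent h]
  exact one_ne_zero

end

end Literature.MathematicalPhysics.QuantumFieldTheory.Balaban1983to89.B12Pairing543Backward
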